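import Summits.QuantumFields.YangMills.Theorems.LuscherReductionTwistedTraceScalingBOCentralChart
import Summits.QuantumFields.YangMills.Theorems.LuscherReductionTwistedTraceScalingBOCentralGlue
import HarnessLib

/-!
# (C1d-ε) ★★★ THE CENTRAL GAUSSIAN AT THE TUBE POINT `orthoTube L 1 v'` with UNIFORM constants, and the (C1) glue fed with `G := A_W(χ₀⊗Ω)` itself
# (lane A of S-BASE, crux `TwistedTraceScaling` stmt-QuantumFields-20203, C4-CORE, the (OD) pen, brick (C1d)+(C1) of `pub/ym-fleet/ym-luscher-20007-p1/COARSE-DESIGN.md` §27.8–§27.9)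

* §1 `stiffGaussExp_zero`, `stiffGaussExp_le_mul_norm_sq` (`q_{t,b}(x) ≤ (96t+b)‖x‖²`);
* §2 ★★★ `central_gaussian_tube_lower` / ★★★ `central_gaussian_tube_upper` — for `β > 0`, `0 < ρ ≤ 1/2`, `0 ≤ T`, `8T ≤ ρ`, `2R ≤ R₁`, a fibre point `v'` with `|v'_{e,c}| ≤ T` and `‖linkEmbed v'‖ ≤ R`,
  and a measurable `0 ≤ G ≤ C_G` with `G(P w) ≤ g₊e^{−q(chartVec w)}` on the chart ball `Σ_a w_e a² ≤ ρ²` and `g₋e^{−q(chartVec w)} ≤ G(P w)` on the part of the ball with `‖chartVec w‖ ≤ R₁`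
  (`q = stiffGaussExp L (β/2) β`):
    `m_d·(stiffGaussTop·e^{−q(linkEmbed v')}) ≤ ∫ K_β(orthoTube L 1 v', V)·G(V) dμ(V) ≤ M_d·(stiffGaussTop·e^{−q(linkEmbed v')})`
  with the `v'`-INDEPENDENT constants
    `m_d = e^{2β|E|}((2π²)⁻¹(1+ρ²)⁻²)^{|E|}e^{−2000|P|ρ³β}·g₋·(e^{−882βT²R²} − e^{49βR²}e^{−β·min(ρ−2T, R₁−2R)²/2}(π/(β/2))^{3|E|/2}/stiffGaussTop)`,
    `M_d = e^{2β|E|}(2π²)^{−|E|}e^{2000|P|ρ³β + 8|E|βρ⁴}·g₊·e^{882βT²R²} + C_G·e^{2β|E|}e^{−βρ²/4}·e^{49βR²}/stiffGaussTop`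
  (`…BOCentralGaussian.central_gaussian_lower_local/upper` at the chart centre `w' = gn ∘ chartSU2 ∘ v'` of `…BOCentralChart.orthoTube_one_eq_latPatternChart`, `ρ' = 2T`, and the conversion
  `|q(chartVec w') − q(linkEmbed v')| ≤ 18·49β·T²R²`, `q(linkEmbed v') ≤ 49βR²`);
* §3 ★★★ `central_transfer_two_sided_of_localisedAvg` — `…BOCentralGlue.central_transfer_two_sided_of_bricks` with `G := A_W(χ₀⊗Ω)` ITSELF (`hC1c` with `m_c = M_c = 1`) and `hC1d` from §2:
  `e^{−η₀}·m_d·P/I₀ ≤ T₁(v') ≤ e^{η₀}·M_d·P/I₀`, `P = stiffGaussTop·e^{−q(linkEmbed v')}`, for every fibre point of the inner core — GIVEN the two-sided Gaussian shape of `A_W(χ₀⊗Ω)` on the chart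
  ball (= (C1c'), the ONLY analytic input left in (C1); cdisprove CAUTION 2 (g36) is moot since no pointwise model `G` of `A_W` is asserted).
With `ρ = β^{-1/2}ℓ²`, `T, R = O(β^{-1/2}ℓ)`, `R₁ − 2R ≥ β^{-1/2}ℓ²`: `m_d/g₋, M_d/g₊ → c₀ := e^{2β|E|}(2π²)^{−|E|}` up to `e^{±O(β^{-1/2}ℓ⁶)}` and additive `e^{−Ω(ℓ⁴)}` (rates file to come).
HONEST FRAMING: Laplace evaluation + glue for a stub of a child of the CONDITIONAL route R2b1; (C1c'), (C4), (C5), (B-ST) OPEN; C4-CORE OPEN; not infinite volume, not a gap, not Clay.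
-/

set_option autoImplicit false

noncomputable section

open MeasureTheory Filter Topology Real
open scoped BigOperators RealInnerProductSpace
open Literature.MathematicalPhysics.QuantumFieldTheory
open Literature.MathematicalPhysics.QuantumLattice
open Literature.MathematicalPhysics.QuantumFieldTheory.Balaban1983to89.T4CubeChartGnomonic (gnoPoint)

namespace Summit.QuantumFields.YangMills.Theorems.FemtoTransferGap.TwoLattice.ConstTube

open Summit.QuantumFields.YangMills.Theorems.FemtoTransferGap
open Summit.QuantumFields.YangMills.Theorems.FemtoTransferGap.TwoLattice
open Summit.QuantumFields.YangMills.Theorems.FemtoTransferGap.TwoLattice.Avg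
open Summit.QuantumFields.YangMills.Theorems.FemtoTransferGap.TwoLattice.Stiff
open Summit.QuantumFields.YangMills.Theorems.FemtoTransferGap.TwoLattice.GnChart

variable {L : ℕ} [NeZero L]

/-! ## §1 Size of the stiff exponent -/

/-- `q_{t,b}(0) = 0`. [folklore] -/
theorem stiffGaussExp_zero (t b : ℝ) : stiffGaussExp L t b 0 = 0 := by
  unfold stiffGaussExp; simp

/-- `q_{t,b}(x) ≤ (96t + b)‖x‖²` (`t, b ≥ 0`). [folklore] -/
theorem stiffGaussExp_le_mul_norm_sq {t : ℝ} (ht : 0 ≤ t) {b : ℝ} (hb : 0 ≤ b) (x : LinkSpace L) : stiffGaussExp L t b x ≤ (96 * t + b) * ‖x‖ ^ 2 := by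
  have h := abs_stiffGaussExp_sub_le ht hb x 0
  rw [stiffGaussExp_zero, sub_zero, sub_zero, add_zero] at h
  calc stiffGaussExp L t b x ≤ |stiffGaussExp L t b x| := le_abs_self _
    _ ≤ (96 * t + b) * ‖x‖ * ‖x‖ := h
    _ = (96 * t + b) * ‖x‖ ^ 2 := by ring

/-- The data of the chart centre of a fibre point: for `|v'_{e,c}| ≤ T`, `8T ≤ ρ ≤ 1/2`, with `w' = gn ∘ chartSU2 ∘ v'`: `orthoTube L 1 v' = P(w')`, `Σ_a w'_e a² ≤ (2T)²`, and for
`‖linkEmbed v'‖ ≤ R`: `‖chartVec w' − linkEmbed v'‖ ≤ 6T²R`, `‖chartVec w'‖ ≤ 2R`, `|q(chartVec w') − q(linkEmbed v')| ≤ 18·(96t+b)·T²R²`. [folklore] -/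
theorem tube_centre_chart_data {t : ℝ} (ht : 0 ≤ t) {b : ℝ} (hb : 0 ≤ b) {ρ T R : ℝ} (hT0 : 0 ≤ T) (hTρ : 8 * T ≤ ρ) (hρ2 : ρ ≤ 1 / 2) {v' : Edge 3 L → Fin 3 → ℝ}
    (hv'T : ∀ (e : Edge 3 L) (c : Fin 3), |v' e c| ≤ T) (hx' : ‖linkEmbed L v'‖ ≤ R) :
    orthoTube L 1 v' = latPatternChart L (fun _ => false) (fun e => gnLink (chartSU2 (v' e))) ∧
      (∀ e, ∑ a, gnLink (chartSU2 (v' e)) a ^ 2 ≤ (2 * T) ^ 2) ∧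
      ‖chartVec (fun e => gnLink (chartSU2 (v' e))) - linkEmbed L v'‖ ≤ 6 * T ^ 2 * R ∧
      ‖chartVec (fun e => gnLink (chartSU2 (v' e)))‖ ≤ 2 * R ∧
      |stiffGaussExp L t b (chartVec (fun e => gnLink (chartSU2 (v' e)))) - stiffGaussExp L t b (linkEmbed L v')| ≤ 18 * (96 * t + b) * T ^ 2 * R ^ 2 := by
  have hT16 : T ≤ 1 / 16 := by linarith
  have hτ : (3 : ℝ) * T ^ 2 ≤ 1 / 4 := by nlinarith
  have hv'τ : ∀ e, ∑ a, v' e a ^ 2 ≤ 3 * T ^ 2 := fun e => by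
    have h : ∀ a, v' e a ^ 2 ≤ T ^ 2 := fun a => by
      have := hv'T e a; rw [← sq_abs]; exact pow_le_pow_left₀ (abs_nonneg _) this 2
    calc ∑ a, v' e a ^ 2 ≤ ∑ _a : Fin 3, T ^ 2 := Finset.sum_le_sum fun a _ => h a
      _ = 3 * T ^ 2 := by simp
  have hcap : ∀ e, ∑ a, v' e a ^ 2 ≤ 1 / 4 := fun e => (hv'τ e).trans hτ
  have hR0 : 0 ≤ R := (norm_nonneg _).trans hx'
  -- `τ² = 3T²`
  have hτdef : (Real.sqrt 3 * T) ^ 2 = 3 * T ^ 2 := by rw [mul_pow, Real.sq_sqrt (by norm_num)]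
  have hv'τ' : ∀ e, ∑ a, v' e a ^ 2 ≤ (Real.sqrt 3 * T) ^ 2 := fun e => by rw [hτdef]; exact hv'τ e
  have hτ' : (Real.sqrt 3 * T) ^ 2 ≤ 1 / 4 := by rw [hτdef]; exact hτ
  refine ⟨orthoTube_one_eq_latPatternChart hcap, fun e => ?_, ?_, ?_, ?_⟩
  · calc ∑ a, gnLink (chartSU2 (v' e)) a ^ 2 ≤ 4 / 3 * ∑ a, v' e a ^ 2 := sum_gnLink_chartSU2_sq_le (hcap e)
      _ ≤ 4 / 3 * (3 * T ^ 2) := by gcongr; exact hv'τ e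
      _ = (2 * T) ^ 2 := by ring
  · calc _ ≤ 2 * (Real.sqrt 3 * T) ^ 2 * ‖linkEmbed L v'‖ := norm_chartVec_gnLink_sub_linkEmbed_le hτ' hv'τ'
      _ = 6 * T ^ 2 * ‖linkEmbed L v'‖ := by rw [hτdef]; ring
      _ ≤ 6 * T ^ 2 * R := by gcongr
  · have h1 : ‖chartVec (fun e => gnLink (chartSU2 (v' e))) - linkEmbed L v'‖ ≤ 6 * T ^ 2 * R := by
      calc _ ≤ 2 * (Real.sqrt 3 * T) ^ 2 * ‖linkEmbed L v'‖ := norm_chartVec_gnLink_sub_linkEmbed_le hτ' hv'τ'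
        _ = 6 * T ^ 2 * ‖linkEmbed L v'‖ := by rw [hτdef]; ring
        _ ≤ 6 * T ^ 2 * R := by gcongr
    have h6 : 6 * T ^ 2 ≤ 1 := by nlinarith
    calc ‖chartVec (fun e => gnLink (chartSU2 (v' e)))‖ = ‖(chartVec (fun e => gnLink (chartSU2 (v' e))) - linkEmbed L v') + linkEmbed L v'‖ := by rw [sub_add_cancel]
      _ ≤ ‖chartVec (fun e => gnLink (chartSU2 (v' e))) - linkEmbed L v'‖ + ‖linkEmbed L v'‖ := norm_add_le _ _
      _ ≤ 6 * T ^ 2 * R + R := add_le_add h1 hx'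
      _ ≤ 2 * R := by nlinarith
  · calc _ ≤ 6 * (96 * t + b) * (Real.sqrt 3 * T) ^ 2 * R ^ 2 := abs_stiffGaussExp_chart_sub_tube_le ht hb hτ' hv'τ' hx'
      _ = 18 * (96 * t + b) * T ^ 2 * R ^ 2 := by rw [hτdef]; ring

/-! ## §2 ★★★ The central Gaussian at the tube point, uniform constants -/

/-- ★★★ **THE CENTRAL GAUSSIAN AT THE TUBE POINT, LOWER BOUND** (see the module docstring for the constants). [cite: Luscher1983, §3] [cite: Wipf2021, §8.5.2] -/
theorem central_gaussian_tube_lower {β : ℝ} (hβ : 0 < β) {ρ T R R₁ : ℝ} (hρ : 0 < ρ) (hρ2 : ρ ≤ 1 / 2) (hT0 : 0 ≤ T) (hTρ : 8 * T ≤ ρ) (hR₁ : 2 * R ≤ R₁)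
    {v' : Edge 3 L → Fin 3 → ℝ} (hv'T : ∀ (e : Edge 3 L) (c : Fin 3), |v' e c| ≤ T) (hx' : ‖linkEmbed L v'‖ ≤ R)
    {G : GaugeConfig 3 L SU2 → ℝ} (hGm : Measurable G) {CG : ℝ} (hCG : ∀ V, |G V| ≤ CG) (hG0 : ∀ V, 0 ≤ G V) {gm : ℝ} (hgm : 0 ≤ gm)
    (hGlo : ∀ w : Edge 3 L → Fin 3 → ℝ, (∀ e, ∑ a, w e a ^ 2 ≤ ρ ^ 2) → ‖chartVec w‖ ≤ R₁ →
      gm * Real.exp (-stiffGaussExp L (β / 2) β (chartVec w)) ≤ G (latPatternChart L (fun _ => false) w)) :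
    Real.exp (2 * β) ^ Fintype.card (Edge 3 L) * ((2 * π ^ 2)⁻¹ * ((1 + ρ ^ 2)⁻¹) ^ 2) ^ Fintype.card (Edge 3 L) *
          Real.exp (-(2000 * Fintype.card (Plaquette 3 L) * ρ ^ 3 * β)) * gm *
        (Real.exp (-(882 * β * T ^ 2 * R ^ 2)) -
          Real.exp (49 * β * R ^ 2) * (Real.exp (-(β * (min (ρ - 2 * T) (R₁ - 2 * R)) ^ 2 / 2)) * (π / (β / 2)) ^ ((Module.finrank ℝ (LinkSpace L) : ℝ) / 2)) /
            stiffGaussTop L (β / 2) β) *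
        (stiffGaussTop L (β / 2) β * Real.exp (-stiffGaussExp L (β / 2) β (linkEmbed L v'))) ≤
      ∫ V, transferKernel su2Rep β (orthoTube L 1 v') V * G V ∂configMeasure SU2 L := by
  have ht : (0 : ℝ) ≤ β / 2 := by positivity
  obtain ⟨hP, hball, hdist, hnorm, hq⟩ := tube_centre_chart_data (L := L) ht hβ.le hT0 hTρ hρ2 hv'T hx'
  set w' : Edge 3 L → Fin 3 → ℝ := fun e => gnLink (chartSU2 (v' e)) with hw'
  set x' := linkEmbed L v' with hx'def
  set S := stiffGaussTop L (β / 2) β with hS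
  have hS0 : 0 < S := stiffGaussTop_pos ht hβ
  set c : ℝ := Real.exp (2 * β) ^ Fintype.card (Edge 3 L) * ((2 * π ^ 2)⁻¹ * ((1 + ρ ^ 2)⁻¹) ^ 2) ^ Fintype.card (Edge 3 L) *
    Real.exp (-(2000 * Fintype.card (Plaquette 3 L) * ρ ^ 3 * β)) * gm with hc
  have hc0 : 0 ≤ c := by positivity
  set tail : ℝ := Real.exp (-(β * (min (ρ - 2 * T) (R₁ - 2 * R)) ^ 2 / 2)) * (π / (β / 2)) ^ ((Module.finrank ℝ (LinkSpace L) : ℝ) / 2) with htail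
  have htail0 : 0 ≤ tail := by positivity
  -- the local lower bound at the chart centre
  have hR₀ : 0 ≤ R₁ - 2 * R := by linarith
  have hGlo' : ∀ w : Edge 3 L → Fin 3 → ℝ, (∀ e, ∑ a, w e a ^ 2 ≤ ρ ^ 2) → ‖chartVec w - chartVec w'‖ ≤ R₁ - 2 * R →
      gm * Real.exp (-stiffGaussExp L (β / 2) β (chartVec w)) ≤ G (latPatternChart L (fun _ => false) w) := fun w hw hnear => by
    refine hGlo w hw ?_
    calc ‖chartVec w‖ = ‖(chartVec w - chartVec w') + chartVec w'‖ := by rw [sub_add_cancel]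
      _ ≤ ‖chartVec w - chartVec w'‖ + ‖chartVec w'‖ := norm_add_le _ _
      _ ≤ (R₁ - 2 * R) + 2 * R := add_le_add hnear hnorm
      _ = R₁ := by ring
  have hmain := central_gaussian_lower_local (L := L) hβ hρ hρ2 (by positivity : (0 : ℝ) ≤ 2 * T) (by linarith : 4 * (2 * T) ≤ ρ) hball hGm hCG hG0 hgm hR₀ hGlo'
  rw [← hP] at hmain
  -- conversion of `e^{−q(chartVec w')}` and of the tail
  have hκ : 18 * (96 * (β / 2) + β) * T ^ 2 * R ^ 2 = 882 * β * T ^ 2 * R ^ 2 := by ring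
  have hexp_lo : Real.exp (-(882 * β * T ^ 2 * R ^ 2)) * Real.exp (-stiffGaussExp L (β / 2) β x') ≤ Real.exp (-stiffGaussExp L (β / 2) β (chartVec w')) := by
    rw [← Real.exp_add]; refine Real.exp_le_exp.2 ?_
    have := (abs_le.1 hq).2
    rw [hκ] at this; linarith
  have hqx' : stiffGaussExp L (β / 2) β x' ≤ 49 * β * R ^ 2 := by
    calc stiffGaussExp L (β / 2) β x' ≤ (96 * (β / 2) + β) * ‖x'‖ ^ 2 := stiffGaussExp_le_mul_norm_sq ht hβ.le x'
      _ ≤ (96 * (β / 2) + β) * R ^ 2 := by gcongr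
      _ = 49 * β * R ^ 2 := by ring
  have htail_conv : tail ≤ Real.exp (49 * β * R ^ 2) * tail / S * (S * Real.exp (-stiffGaussExp L (β / 2) β x')) := by
    have h1 : Real.exp (49 * β * R ^ 2) * tail / S * (S * Real.exp (-stiffGaussExp L (β / 2) β x')) =
        tail * (Real.exp (49 * β * R ^ 2) * Real.exp (-stiffGaussExp L (β / 2) β x')) := by field_simp
    rw [h1, ← Real.exp_add]
    have h2 : 1 ≤ Real.exp (49 * β * R ^ 2 + -stiffGaussExp L (β / 2) β x') := Real.one_le_exp (by linarith)
    nlinarith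
  -- assemble
  have hstep : S * Real.exp (-stiffGaussExp L (β / 2) β (chartVec w')) - tail ≥
      (Real.exp (-(882 * β * T ^ 2 * R ^ 2)) - Real.exp (49 * β * R ^ 2) * tail / S) * (S * Real.exp (-stiffGaussExp L (β / 2) β x')) := by
    have h1 : S * (Real.exp (-(882 * β * T ^ 2 * R ^ 2)) * Real.exp (-stiffGaussExp L (β / 2) β x')) ≤ S * Real.exp (-stiffGaussExp L (β / 2) β (chartVec w')) :=
      mul_le_mul_of_nonneg_left hexp_lo hS0.le
    nlinarith
  calc _ = c * ((Real.exp (-(882 * β * T ^ 2 * R ^ 2)) - Real.exp (49 * β * R ^ 2) * tail / S) * (S * Real.exp (-stiffGaussExp L (β / 2) β x'))) := by rw [hc]; ring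
    _ ≤ c * (S * Real.exp (-stiffGaussExp L (β / 2) β (chartVec w')) - tail) := mul_le_mul_of_nonneg_left hstep hc0
    _ = _ := by rw [hc]
    _ ≤ _ := hmain

/-- ★★★ **THE CENTRAL GAUSSIAN AT THE TUBE POINT, UPPER BOUND** (see the module docstring for the constants). [cite: Luscher1983, §3] [cite: Wipf2021, §8.5.2] -/
theorem central_gaussian_tube_upper {β : ℝ} (hβ : 0 < β) {ρ T R : ℝ} (hρ : 0 < ρ) (hρ2 : ρ ≤ 1 / 2) (hT0 : 0 ≤ T) (hTρ : 8 * T ≤ ρ)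
    {v' : Edge 3 L → Fin 3 → ℝ} (hv'T : ∀ (e : Edge 3 L) (c : Fin 3), |v' e c| ≤ T) (hx' : ‖linkEmbed L v'‖ ≤ R)
    {G : GaugeConfig 3 L SU2 → ℝ} (hGm : Measurable G) {CG : ℝ} (hCG : ∀ V, |G V| ≤ CG) (hG0 : ∀ V, 0 ≤ G V) {gp : ℝ}
    (hGhi : ∀ w : Edge 3 L → Fin 3 → ℝ, (∀ e, ∑ a, w e a ^ 2 ≤ ρ ^ 2) → G (latPatternChart L (fun _ => false) w) ≤ gp * Real.exp (-stiffGaussExp L (β / 2) β (chartVec w))) :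
    ∫ V, transferKernel su2Rep β (orthoTube L 1 v') V * G V ∂configMeasure SU2 L ≤
      (Real.exp (2 * β) ^ Fintype.card (Edge 3 L) * ((2 * π ^ 2)⁻¹) ^ Fintype.card (Edge 3 L) * Real.exp (2000 * Fintype.card (Plaquette 3 L) * ρ ^ 3 * β) *
            Real.exp (8 * Fintype.card (Edge 3 L) * β * ρ ^ 4) * gp * Real.exp (882 * β * T ^ 2 * R ^ 2) +
          CG * (Real.exp (2 * β) ^ Fintype.card (Edge 3 L) * Real.exp (-(β * ρ ^ 2 / 4))) * Real.exp (49 * β * R ^ 2) / stiffGaussTop L (β / 2) β) *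
        (stiffGaussTop L (β / 2) β * Real.exp (-stiffGaussExp L (β / 2) β (linkEmbed L v'))) := by
  have ht : (0 : ℝ) ≤ β / 2 := by positivity
  obtain ⟨hP, hball, hdist, hnorm, hq⟩ := tube_centre_chart_data (L := L) ht hβ.le hT0 hTρ hρ2 hv'T hx'
  set w' : Edge 3 L → Fin 3 → ℝ := fun e => gnLink (chartSU2 (v' e)) with hw'
  set x' := linkEmbed L v' with hx'def
  set S := stiffGaussTop L (β / 2) β with hS
  have hS0 : 0 < S := stiffGaussTop_pos ht hβ
  set chi : ℝ := Real.exp (2 * β) ^ Fintype.card (Edge 3 L) * ((2 * π ^ 2)⁻¹) ^ Fintype.card (Edge 3 L) * Real.exp (2000 * Fintype.card (Plaquette 3 L) * ρ ^ 3 * β) *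
    Real.exp (8 * Fintype.card (Edge 3 L) * β * ρ ^ 4) with hchi
  set far : ℝ := Real.exp (2 * β) ^ Fintype.card (Edge 3 L) * Real.exp (-(β * ρ ^ 2 / 4)) with hfar
  have hCG0 : 0 ≤ CG := (abs_nonneg _).trans (hCG 1)
  have hgp : 0 ≤ gp := by
    have h := (hG0 _).trans (hGhi w' (fun e => (hball e).trans (by nlinarith)))
    exact nonneg_of_mul_nonneg_left (by rwa [mul_comm] at h) (Real.exp_pos _)
  have hmain := central_gaussian_upper (L := L) hβ hρ hρ2 (by positivity : (0 : ℝ) ≤ 2 * T) (by linarith : 4 * (2 * T) ≤ ρ) hball hGm hCG hG0 hGhi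
  rw [← hP] at hmain
  have hκ : 18 * (96 * (β / 2) + β) * T ^ 2 * R ^ 2 = 882 * β * T ^ 2 * R ^ 2 := by ring
  have hexp_hi : Real.exp (-stiffGaussExp L (β / 2) β (chartVec w')) ≤ Real.exp (882 * β * T ^ 2 * R ^ 2) * Real.exp (-stiffGaussExp L (β / 2) β x') := by
    rw [← Real.exp_add]; refine Real.exp_le_exp.2 ?_
    have := (abs_le.1 hq).1
    rw [hκ] at this; linarith
  have hqx' : stiffGaussExp L (β / 2) β x' ≤ 49 * β * R ^ 2 := by
    calc stiffGaussExp L (β / 2) β x' ≤ (96 * (β / 2) + β) * ‖x'‖ ^ 2 := stiffGaussExp_le_mul_norm_sq ht hβ.le x'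
      _ ≤ (96 * (β / 2) + β) * R ^ 2 := by gcongr
      _ = 49 * β * R ^ 2 := by ring
  have hfar_conv : CG * far ≤ CG * far * Real.exp (49 * β * R ^ 2) / S * (S * Real.exp (-stiffGaussExp L (β / 2) β x')) := by
    have h1 : CG * far * Real.exp (49 * β * R ^ 2) / S * (S * Real.exp (-stiffGaussExp L (β / 2) β x')) =
        CG * far * (Real.exp (49 * β * R ^ 2) * Real.exp (-stiffGaussExp L (β / 2) β x')) := by field_simp
    rw [h1, ← Real.exp_add]
    have h2 : 1 ≤ Real.exp (49 * β * R ^ 2 + -stiffGaussExp L (β / 2) β x') := Real.one_le_exp (by linarith)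
    have h3 : 0 ≤ CG * far := by positivity
    nlinarith
  have h1 : chi * gp * (S * Real.exp (-stiffGaussExp L (β / 2) β (chartVec w'))) ≤ chi * gp * Real.exp (882 * β * T ^ 2 * R ^ 2) * (S * Real.exp (-stiffGaussExp L (β / 2) β x')) := by
    have := mul_le_mul_of_nonneg_left hexp_hi (by positivity : 0 ≤ chi * gp * S)
    nlinarith
  calc _ ≤ chi * gp * (S * Real.exp (-stiffGaussExp L (β / 2) β (chartVec w'))) + CG * far := hmain
    _ ≤ chi * gp * Real.exp (882 * β * T ^ 2 * R ^ 2) * (S * Real.exp (-stiffGaussExp L (β / 2) β x')) +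
        CG * far * Real.exp (49 * β * R ^ 2) / S * (S * Real.exp (-stiffGaussExp L (β / 2) β x')) := add_le_add h1 hfar_conv
    _ = _ := by rw [hchi, hfar]; ring

/-! ## §3 ★★★ The (C1) glue fed with the localised average itself -/

/-- ★★★ **(C1) FROM (C1c') ALONE**: the central transfer `T₁(v') = fpFibreTransfer β Ω W (orthoTube L 1 v') 1` is sandwiched by `e^{∓η₀}·m_d/M_d·stiffGaussTop·e^{−q(linkEmbed v')}/I₀`
as soon as the `W`-localised gauge average `A(V) = ∫_g W(g)·boFun χ₀ Ω (V^{g⁻¹}) dg` is two-sided Gaussian on the chart ball (`g₋e^{−q(chartVec w)} ≤ A(P w)` for `‖chartVec w‖ ≤ R₁`,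
`A(P w) ≤ g₊e^{−q(chartVec w)}` on the whole ball).  All other hypotheses are those of `…BOCentralGlue.central_transfer_two_sided_of_bricks`. [cite: Luscher1983, §3] -/
theorem central_transfer_two_sided_of_localisedAvg {β : ℝ} (hβ : 0 < β) {Ω : LinkSpace L → ℝ} (hΩm : Measurable Ω) {CΩ : ℝ} (hCΩ : ∀ x, |Ω x| ≤ CΩ) (hΩ0 : ∀ x, 0 ≤ Ω x)
    {W : (Site 3 L → SU2) → ℝ} (hW : Measurable W) {CW : ℝ} (hCW : ∀ g, |W g| ≤ CW) (hW0 : ∀ g, 0 ≤ W g)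
    {δu T R Γ σ : ℝ} (hδu1 : δu ≤ 1) (hT0 : 0 ≤ T) (hT : T ≤ 1 / 30) (hσ0 : 0 ≤ σ) (hσ : σ < 2)
    (hΩt : ∀ v : Edge 3 L → Fin 3 → ℝ, Ω (linkEmbed L v) ≠ 0 → v ∈ capBalancedSet L ∧ (∀ (e : Edge 3 L) (c : Fin 3), |v e c| ≤ T) ∧ ‖linkEmbed L v‖ ≤ R)
    (hWc : ∀ g : Site 3 L → SU2, W g ≠ 0 → (∀ x, ‖su2Quat (g x) - 1‖ ≤ T) ∧ ‖∑ x, vecPart (g x)‖ ≤ Γ)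
    {χ₀ : GaugeConfig 3 1 SU2 → ℝ} (hχm : Measurable χ₀) {Cχ : ℝ} (hCχ : ∀ u, |χ₀ u| ≤ Cχ) (hχ0 : ∀ u, 0 ≤ χ₀ u)
    (hχw : ∀ u, χ₀ u ≠ 0 → (∀ k : Fin 3, ‖su2Quat (u (0, k)) - 1‖ ≤ δu) ∧ (L : ℝ) ^ 3 * wilsonAction su2Rep u ≤ σ)
    (hI0 : 0 < ∫ u, χ₀ u * (transferKernel su2Rep ((L : ℝ) ^ 3 * β) (1 : GaugeConfig 3 1 SU2) u / transferKernel su2Rep ((L : ℝ) ^ 3 * β) (1 : GaugeConfig 3 1 SU2) 1)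
      ∂configMeasure SU2 1)
    {v' : Edge 3 L → Fin 3 → ℝ} (hv' : v' ∈ capBalancedSet L) (hv'T : ∀ (e : Edge 3 L) (c : Fin 3), |v' e c| ≤ T) (hx' : ‖linkEmbed L v'‖ ≤ R)
    -- the chart radius and the inner radius of the lower Gaussian hypothesis
    {ρ R₁ : ℝ} (hρ : 0 < ρ) (hρ2 : ρ ≤ 1 / 2) (hTρ : 8 * T ≤ ρ) (hR₁ : 2 * R ≤ R₁)
    -- (C1c'): the localised average is two-sided Gaussian on the chart ball
    {gm gp : ℝ} (hgm : 0 ≤ gm)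
    (hAlo : ∀ w : Edge 3 L → Fin 3 → ℝ, (∀ e, ∑ a, w e a ^ 2 ≤ ρ ^ 2) → ‖chartVec w‖ ≤ R₁ →
      gm * Real.exp (-stiffGaussExp L (β / 2) β (chartVec w)) ≤ ∫ g, W g * boFun L χ₀ Ω (gaugeTransform g⁻¹ (latPatternChart L (fun _ => false) w)) ∂gaugeMeasure L)
    (hAhi : ∀ w : Edge 3 L → Fin 3 → ℝ, (∀ e, ∑ a, w e a ^ 2 ≤ ρ ^ 2) →
      ∫ g, W g * boFun L χ₀ Ω (gaugeTransform g⁻¹ (latPatternChart L (fun _ => false) w)) ∂gaugeMeasure L ≤ gp * Real.exp (-stiffGaussExp L (β / 2) β (chartVec w))) :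
    Real.exp (-(coreEta L β 0 δu T R Γ σ + coreEps1 L β 0 T R + coreEps2 L β 0 T R σ)) *
          (1 * (Real.exp (2 * β) ^ Fintype.card (Edge 3 L) * ((2 * π ^ 2)⁻¹ * ((1 + ρ ^ 2)⁻¹) ^ 2) ^ Fintype.card (Edge 3 L) *
              Real.exp (-(2000 * Fintype.card (Plaquette 3 L) * ρ ^ 3 * β)) * gm *
            (Real.exp (-(882 * β * T ^ 2 * R ^ 2)) -
              Real.exp (49 * β * R ^ 2) * (Real.exp (-(β * (min (ρ - 2 * T) (R₁ - 2 * R)) ^ 2 / 2)) * (π / (β / 2)) ^ ((Module.finrank ℝ (LinkSpace L) : ℝ) / 2)) /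
                stiffGaussTop L (β / 2) β)) *
            (stiffGaussTop L (β / 2) β * Real.exp (-stiffGaussExp L (β / 2) β (linkEmbed L v')))) /
          (∫ u, χ₀ u * (transferKernel su2Rep ((L : ℝ) ^ 3 * β) (1 : GaugeConfig 3 1 SU2) u / transferKernel su2Rep ((L : ℝ) ^ 3 * β) (1 : GaugeConfig 3 1 SU2) 1)
            ∂configMeasure SU2 1) ≤ fpFibreTransfer L β Ω W (orthoTube L 1 v') 1 ∧
      fpFibreTransfer L β Ω W (orthoTube L 1 v') 1 ≤
        Real.exp (coreEta L β 0 δu T R Γ σ + coreEps1 L β 0 T R + coreEps2 L β 0 T R σ) *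
          (1 * (Real.exp (2 * β) ^ Fintype.card (Edge 3 L) * ((2 * π ^ 2)⁻¹) ^ Fintype.card (Edge 3 L) * Real.exp (2000 * Fintype.card (Plaquette 3 L) * ρ ^ 3 * β) *
                Real.exp (8 * Fintype.card (Edge 3 L) * β * ρ ^ 4) * gp * Real.exp (882 * β * T ^ 2 * R ^ 2) +
              Cχ * CΩ * CW * (Real.exp (2 * β) ^ Fintype.card (Edge 3 L) * Real.exp (-(β * ρ ^ 2 / 4))) * Real.exp (49 * β * R ^ 2) / stiffGaussTop L (β / 2) β) *
            (stiffGaussTop L (β / 2) β * Real.exp (-stiffGaussExp L (β / 2) β (linkEmbed L v')))) /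
          (∫ u, χ₀ u * (transferKernel su2Rep ((L : ℝ) ^ 3 * β) (1 : GaugeConfig 3 1 SU2) u / transferKernel su2Rep ((L : ℝ) ^ 3 * β) (1 : GaugeConfig 3 1 SU2) 1)
            ∂configMeasure SU2 1) := by
  haveI : IsProbabilityMeasure (gaugeMeasure L) := by unfold gaugeMeasure; infer_instance
  set A : GaugeConfig 3 L SU2 → ℝ := fun V => ∫ g, W g * boFun L χ₀ Ω (gaugeTransform g⁻¹ V) ∂gaugeMeasure L with hA
  obtain ⟨hAm, hAb⟩ := localisedAvg_boFun_props hΩm hCΩ hW hCW hχm hCχ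
  have hCW0 : 0 ≤ CW := (abs_nonneg _).trans (hCW 1)
  have hCχ0 : 0 ≤ Cχ := (abs_nonneg _).trans (hCχ 1)
  have hCΩ0 : 0 ≤ CΩ := (abs_nonneg _).trans (hCΩ 0)
  -- `A ≥ 0` and `|A| ≤ Cχ·CΩ·CW`
  have hbo0 : ∀ V, 0 ≤ boFun L χ₀ Ω V := fun V => by
    unfold boFun; exact mul_nonneg (Set.indicator_nonneg (fun _ _ => zero_le_one) _) (mul_nonneg (hχ0 _) (hΩ0 _))
  have hA0 : ∀ V, 0 ≤ A V := fun V => integral_nonneg fun g => mul_nonneg (hW0 g) (hbo0 _)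
  have hAC : ∀ V, |A V| ≤ Cχ * CΩ * CW := fun V => (hAb V).trans (le_of_eq (by ring))
  -- the two bricks
  have hC1c : ∀ V : GaugeConfig 3 L SU2, 1 * A V ≤ ∫ g, W g * boFun L χ₀ Ω (gaugeTransform g⁻¹ V) ∂gaugeMeasure L ∧
      ∫ g, W g * boFun L χ₀ Ω (gaugeTransform g⁻¹ V) ∂gaugeMeasure L ≤ 1 * A V := fun V => by rw [one_mul]; exact ⟨le_rfl, le_rfl⟩
  have hlo := central_gaussian_tube_lower (L := L) hβ hρ hρ2 hT0 hTρ hR₁ hv'T hx' hAm hAC hA0 hgm hAlo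
  have hhi := central_gaussian_tube_upper (L := L) hβ hρ hρ2 hT0 hTρ hv'T hx' hAm hAC hA0 hAhi
  exact central_transfer_two_sided_of_bricks hβ.le hΩm hCΩ hΩ0 hW hCW hW0 hδu1 hT hσ0 hσ hΩt hWc hχm hCχ hχ0 hχw hI0 hv' hv'T hx' hAm hAC zero_le_one zero_le_one
    hC1c ⟨hlo, hhi⟩

/-! ## §4 The relative-local forms -/

/-- ★★★ **THE CENTRAL GAUSSIAN AT THE TUBE POINT, LOWER BOUND, RELATIVE-LOCAL HYPOTHESIS**: as `central_gaussian_tube_lower`, but the Gaussian lower bound on `G` is assumed only for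
chart points within Euclidean distance `R₀` of the tube coordinate `linkEmbed v'` (`6T²R ≤ R₀`); tail radius `min(ρ − 2T, R₀ − 6T²R)`.  This is the form the (C1c') supplier can deliver
(the localised average is Gaussian from below only near fibre points of the inner core: inside the support ball of the profile AND gauge-close to the slice). [cite: Luscher1983, §3] [cite: Wipf2021, §8.5.2] -/
theorem central_gaussian_tube_lower_local {β : ℝ} (hβ : 0 < β) {ρ T R R₀ : ℝ} (hρ : 0 < ρ) (hρ2 : ρ ≤ 1 / 2) (hT0 : 0 ≤ T) (hTρ : 8 * T ≤ ρ) (hR₀ : 6 * T ^ 2 * R ≤ R₀)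
    {v' : Edge 3 L → Fin 3 → ℝ} (hv'T : ∀ (e : Edge 3 L) (c : Fin 3), |v' e c| ≤ T) (hx' : ‖linkEmbed L v'‖ ≤ R)
    {G : GaugeConfig 3 L SU2 → ℝ} (hGm : Measurable G) {CG : ℝ} (hCG : ∀ V, |G V| ≤ CG) (hG0 : ∀ V, 0 ≤ G V) {gm : ℝ} (hgm : 0 ≤ gm)
    (hGlo : ∀ w : Edge 3 L → Fin 3 → ℝ, (∀ e, ∑ a, w e a ^ 2 ≤ ρ ^ 2) → ‖chartVec w - linkEmbed L v'‖ ≤ R₀ →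
      gm * Real.exp (-stiffGaussExp L (β / 2) β (chartVec w)) ≤ G (latPatternChart L (fun _ => false) w)) :
    Real.exp (2 * β) ^ Fintype.card (Edge 3 L) * ((2 * π ^ 2)⁻¹ * ((1 + ρ ^ 2)⁻¹) ^ 2) ^ Fintype.card (Edge 3 L) *
          Real.exp (-(2000 * Fintype.card (Plaquette 3 L) * ρ ^ 3 * β)) * gm *
        (Real.exp (-(882 * β * T ^ 2 * R ^ 2)) -
          Real.exp (49 * β * R ^ 2) * (Real.exp (-(β * (min (ρ - 2 * T) (R₀ - 6 * T ^ 2 * R)) ^ 2 / 2)) * (π / (β / 2)) ^ ((Module.finrank ℝ (LinkSpace L) : ℝ) / 2)) /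
            stiffGaussTop L (β / 2) β) *
        (stiffGaussTop L (β / 2) β * Real.exp (-stiffGaussExp L (β / 2) β (linkEmbed L v'))) ≤
      ∫ V, transferKernel su2Rep β (orthoTube L 1 v') V * G V ∂configMeasure SU2 L := by
  have ht : (0 : ℝ) ≤ β / 2 := by positivity
  obtain ⟨hP, hball, hdist, hnorm, hq⟩ := tube_centre_chart_data (L := L) ht hβ.le hT0 hTρ hρ2 hv'T hx'
  set w' : Edge 3 L → Fin 3 → ℝ := fun e => gnLink (chartSU2 (v' e)) with hw'
  set x' := linkEmbed L v' with hx'def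
  set S := stiffGaussTop L (β / 2) β with hS
  have hS0 : 0 < S := stiffGaussTop_pos ht hβ
  set c : ℝ := Real.exp (2 * β) ^ Fintype.card (Edge 3 L) * ((2 * π ^ 2)⁻¹ * ((1 + ρ ^ 2)⁻¹) ^ 2) ^ Fintype.card (Edge 3 L) *
    Real.exp (-(2000 * Fintype.card (Plaquette 3 L) * ρ ^ 3 * β)) * gm with hc
  have hc0 : 0 ≤ c := by positivity
  set tail : ℝ := Real.exp (-(β * (min (ρ - 2 * T) (R₀ - 6 * T ^ 2 * R)) ^ 2 / 2)) * (π / (β / 2)) ^ ((Module.finrank ℝ (LinkSpace L) : ℝ) / 2) with htail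
  have htail0 : 0 ≤ tail := by positivity
  -- the local lower bound at the chart centre
  have hR₀' : 0 ≤ R₀ - 6 * T ^ 2 * R := by linarith
  have hGlo' : ∀ w : Edge 3 L → Fin 3 → ℝ, (∀ e, ∑ a, w e a ^ 2 ≤ ρ ^ 2) → ‖chartVec w - chartVec w'‖ ≤ R₀ - 6 * T ^ 2 * R →
      gm * Real.exp (-stiffGaussExp L (β / 2) β (chartVec w)) ≤ G (latPatternChart L (fun _ => false) w) := fun w hw hnear => by
    refine hGlo w hw ?_
    calc ‖chartVec w - x'‖ = ‖(chartVec w - chartVec w') + (chartVec w' - x')‖ := by rw [sub_add_sub_cancel]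
      _ ≤ ‖chartVec w - chartVec w'‖ + ‖chartVec w' - x'‖ := norm_add_le _ _
      _ ≤ (R₀ - 6 * T ^ 2 * R) + 6 * T ^ 2 * R := add_le_add hnear hdist
      _ = R₀ := by ring
  have hmain := central_gaussian_lower_local (L := L) hβ hρ hρ2 (by positivity : (0 : ℝ) ≤ 2 * T) (by linarith : 4 * (2 * T) ≤ ρ) hball hGm hCG hG0 hgm hR₀' hGlo'
  rw [← hP] at hmain
  -- conversion of `e^{−q(chartVec w')}` and of the tail
  have hκ : 18 * (96 * (β / 2) + β) * T ^ 2 * R ^ 2 = 882 * β * T ^ 2 * R ^ 2 := by ring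
  have hexp_lo : Real.exp (-(882 * β * T ^ 2 * R ^ 2)) * Real.exp (-stiffGaussExp L (β / 2) β x') ≤ Real.exp (-stiffGaussExp L (β / 2) β (chartVec w')) := by
    rw [← Real.exp_add]; refine Real.exp_le_exp.2 ?_
    have := (abs_le.1 hq).2
    rw [hκ] at this; linarith
  have hqx' : stiffGaussExp L (β / 2) β x' ≤ 49 * β * R ^ 2 := by
    calc stiffGaussExp L (β / 2) β x' ≤ (96 * (β / 2) + β) * ‖x'‖ ^ 2 := stiffGaussExp_le_mul_norm_sq ht hβ.le x'
      _ ≤ (96 * (β / 2) + β) * R ^ 2 := by gcongr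
      _ = 49 * β * R ^ 2 := by ring
  have htail_conv : tail ≤ Real.exp (49 * β * R ^ 2) * tail / S * (S * Real.exp (-stiffGaussExp L (β / 2) β x')) := by
    have h1 : Real.exp (49 * β * R ^ 2) * tail / S * (S * Real.exp (-stiffGaussExp L (β / 2) β x')) =
        tail * (Real.exp (49 * β * R ^ 2) * Real.exp (-stiffGaussExp L (β / 2) β x')) := by field_simp
    rw [h1, ← Real.exp_add]
    have h2 : 1 ≤ Real.exp (49 * β * R ^ 2 + -stiffGaussExp L (β / 2) β x') := Real.one_le_exp (by linarith)
    nlinarith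
  -- assemble
  have hstep : S * Real.exp (-stiffGaussExp L (β / 2) β (chartVec w')) - tail ≥
      (Real.exp (-(882 * β * T ^ 2 * R ^ 2)) - Real.exp (49 * β * R ^ 2) * tail / S) * (S * Real.exp (-stiffGaussExp L (β / 2) β x')) := by
    have h1 : S * (Real.exp (-(882 * β * T ^ 2 * R ^ 2)) * Real.exp (-stiffGaussExp L (β / 2) β x')) ≤ S * Real.exp (-stiffGaussExp L (β / 2) β (chartVec w')) :=
      mul_le_mul_of_nonneg_left hexp_lo hS0.le
    nlinarith
  calc _ = c * ((Real.exp (-(882 * β * T ^ 2 * R ^ 2)) - Real.exp (49 * β * R ^ 2) * tail / S) * (S * Real.exp (-stiffGaussExp L (β / 2) β x'))) := by rw [hc]; ring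
    _ ≤ c * (S * Real.exp (-stiffGaussExp L (β / 2) β (chartVec w')) - tail) := mul_le_mul_of_nonneg_left hstep hc0
    _ = _ := by rw [hc]
    _ ≤ _ := hmain

/-- ★★★ **(C1) FROM (C1c') ALONE, RELATIVE-LOCAL FORM**: as `central_transfer_two_sided_of_localisedAvg`, with the Gaussian lower bound on the localised average assumed only within
Euclidean chart distance `R₀` of the tube coordinate `linkEmbed v'` (`6T²R ≤ R₀`; tail radius `min(ρ − 2T, R₀ − 6T²R)`). [cite: Luscher1983, §3] -/
theorem central_transfer_two_sided_of_localisedAvg_local {β : ℝ} (hβ : 0 < β) {Ω : LinkSpace L → ℝ} (hΩm : Measurable Ω) {CΩ : ℝ} (hCΩ : ∀ x, |Ω x| ≤ CΩ) (hΩ0 : ∀ x, 0 ≤ Ω x)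
    {W : (Site 3 L → SU2) → ℝ} (hW : Measurable W) {CW : ℝ} (hCW : ∀ g, |W g| ≤ CW) (hW0 : ∀ g, 0 ≤ W g)
    {δu T R Γ σ : ℝ} (hδu1 : δu ≤ 1) (hT0 : 0 ≤ T) (hT : T ≤ 1 / 30) (hσ0 : 0 ≤ σ) (hσ : σ < 2)
    (hΩt : ∀ v : Edge 3 L → Fin 3 → ℝ, Ω (linkEmbed L v) ≠ 0 → v ∈ capBalancedSet L ∧ (∀ (e : Edge 3 L) (c : Fin 3), |v e c| ≤ T) ∧ ‖linkEmbed L v‖ ≤ R)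
    (hWc : ∀ g : Site 3 L → SU2, W g ≠ 0 → (∀ x, ‖su2Quat (g x) - 1‖ ≤ T) ∧ ‖∑ x, vecPart (g x)‖ ≤ Γ)
    {χ₀ : GaugeConfig 3 1 SU2 → ℝ} (hχm : Measurable χ₀) {Cχ : ℝ} (hCχ : ∀ u, |χ₀ u| ≤ Cχ) (hχ0 : ∀ u, 0 ≤ χ₀ u)
    (hχw : ∀ u, χ₀ u ≠ 0 → (∀ k : Fin 3, ‖su2Quat (u (0, k)) - 1‖ ≤ δu) ∧ (L : ℝ) ^ 3 * wilsonAction su2Rep u ≤ σ)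
    (hI0 : 0 < ∫ u, χ₀ u * (transferKernel su2Rep ((L : ℝ) ^ 3 * β) (1 : GaugeConfig 3 1 SU2) u / transferKernel su2Rep ((L : ℝ) ^ 3 * β) (1 : GaugeConfig 3 1 SU2) 1)
      ∂configMeasure SU2 1)
    {v' : Edge 3 L → Fin 3 → ℝ} (hv' : v' ∈ capBalancedSet L) (hv'T : ∀ (e : Edge 3 L) (c : Fin 3), |v' e c| ≤ T) (hx' : ‖linkEmbed L v'‖ ≤ R)
    -- the chart radius and the inner radius of the lower Gaussian hypothesis
    {ρ R₀ : ℝ} (hρ : 0 < ρ) (hρ2 : ρ ≤ 1 / 2) (hTρ : 8 * T ≤ ρ) (hR₀ : 6 * T ^ 2 * R ≤ R₀)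
    -- (C1c'): the localised average is two-sided Gaussian on the chart ball
    {gm gp : ℝ} (hgm : 0 ≤ gm)
    (hAlo : ∀ w : Edge 3 L → Fin 3 → ℝ, (∀ e, ∑ a, w e a ^ 2 ≤ ρ ^ 2) → ‖chartVec w - linkEmbed L v'‖ ≤ R₀ →
      gm * Real.exp (-stiffGaussExp L (β / 2) β (chartVec w)) ≤ ∫ g, W g * boFun L χ₀ Ω (gaugeTransform g⁻¹ (latPatternChart L (fun _ => false) w)) ∂gaugeMeasure L)
    (hAhi : ∀ w : Edge 3 L → Fin 3 → ℝ, (∀ e, ∑ a, w e a ^ 2 ≤ ρ ^ 2) →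
      ∫ g, W g * boFun L χ₀ Ω (gaugeTransform g⁻¹ (latPatternChart L (fun _ => false) w)) ∂gaugeMeasure L ≤ gp * Real.exp (-stiffGaussExp L (β / 2) β (chartVec w))) :
    Real.exp (-(coreEta L β 0 δu T R Γ σ + coreEps1 L β 0 T R + coreEps2 L β 0 T R σ)) *
          (1 * (Real.exp (2 * β) ^ Fintype.card (Edge 3 L) * ((2 * π ^ 2)⁻¹ * ((1 + ρ ^ 2)⁻¹) ^ 2) ^ Fintype.card (Edge 3 L) *
              Real.exp (-(2000 * Fintype.card (Plaquette 3 L) * ρ ^ 3 * β)) * gm *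
            (Real.exp (-(882 * β * T ^ 2 * R ^ 2)) -
              Real.exp (49 * β * R ^ 2) * (Real.exp (-(β * (min (ρ - 2 * T) (R₀ - 6 * T ^ 2 * R)) ^ 2 / 2)) * (π / (β / 2)) ^ ((Module.finrank ℝ (LinkSpace L) : ℝ) / 2)) /
                stiffGaussTop L (β / 2) β)) *
            (stiffGaussTop L (β / 2) β * Real.exp (-stiffGaussExp L (β / 2) β (linkEmbed L v')))) /
          (∫ u, χ₀ u * (transferKernel su2Rep ((L : ℝ) ^ 3 * β) (1 : GaugeConfig 3 1 SU2) u / transferKernel su2Rep ((L : ℝ) ^ 3 * β) (1 : GaugeConfig 3 1 SU2) 1)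
            ∂configMeasure SU2 1) ≤ fpFibreTransfer L β Ω W (orthoTube L 1 v') 1 ∧
      fpFibreTransfer L β Ω W (orthoTube L 1 v') 1 ≤
        Real.exp (coreEta L β 0 δu T R Γ σ + coreEps1 L β 0 T R + coreEps2 L β 0 T R σ) *
          (1 * (Real.exp (2 * β) ^ Fintype.card (Edge 3 L) * ((2 * π ^ 2)⁻¹) ^ Fintype.card (Edge 3 L) * Real.exp (2000 * Fintype.card (Plaquette 3 L) * ρ ^ 3 * β) *
                Real.exp (8 * Fintype.card (Edge 3 L) * β * ρ ^ 4) * gp * Real.exp (882 * β * T ^ 2 * R ^ 2) +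
              Cχ * CΩ * CW * (Real.exp (2 * β) ^ Fintype.card (Edge 3 L) * Real.exp (-(β * ρ ^ 2 / 4))) * Real.exp (49 * β * R ^ 2) / stiffGaussTop L (β / 2) β) *
            (stiffGaussTop L (β / 2) β * Real.exp (-stiffGaussExp L (β / 2) β (linkEmbed L v')))) /
          (∫ u, χ₀ u * (transferKernel su2Rep ((L : ℝ) ^ 3 * β) (1 : GaugeConfig 3 1 SU2) u / transferKernel su2Rep ((L : ℝ) ^ 3 * β) (1 : GaugeConfig 3 1 SU2) 1)
            ∂configMeasure SU2 1) := by
  haveI : IsProbabilityMeasure (gaugeMeasure L) := by unfold gaugeMeasure; infer_instance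
  set A : GaugeConfig 3 L SU2 → ℝ := fun V => ∫ g, W g * boFun L χ₀ Ω (gaugeTransform g⁻¹ V) ∂gaugeMeasure L with hA
  obtain ⟨hAm, hAb⟩ := localisedAvg_boFun_props hΩm hCΩ hW hCW hχm hCχ
  have hCW0 : 0 ≤ CW := (abs_nonneg _).trans (hCW 1)
  have hCχ0 : 0 ≤ Cχ := (abs_nonneg _).trans (hCχ 1)
  have hCΩ0 : 0 ≤ CΩ := (abs_nonneg _).trans (hCΩ 0)
  -- `A ≥ 0` and `|A| ≤ Cχ·CΩ·CW`
  have hbo0 : ∀ V, 0 ≤ boFun L χ₀ Ω V := fun V => by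
    unfold boFun; exact mul_nonneg (Set.indicator_nonneg (fun _ _ => zero_le_one) _) (mul_nonneg (hχ0 _) (hΩ0 _))
  have hA0 : ∀ V, 0 ≤ A V := fun V => integral_nonneg fun g => mul_nonneg (hW0 g) (hbo0 _)
  have hAC : ∀ V, |A V| ≤ Cχ * CΩ * CW := fun V => (hAb V).trans (le_of_eq (by ring))
  -- the two bricks
  have hC1c : ∀ V : GaugeConfig 3 L SU2, 1 * A V ≤ ∫ g, W g * boFun L χ₀ Ω (gaugeTransform g⁻¹ V) ∂gaugeMeasure L ∧
      ∫ g, W g * boFun L χ₀ Ω (gaugeTransform g⁻¹ V) ∂gaugeMeasure L ≤ 1 * A V := fun V => by rw [one_mul]; exact ⟨le_rfl, le_rfl⟩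
  have hlo := central_gaussian_tube_lower_local (L := L) hβ hρ hρ2 hT0 hTρ hR₀ hv'T hx' hAm hAC hA0 hgm hAlo
  have hhi := central_gaussian_tube_upper (L := L) hβ hρ hρ2 hT0 hTρ hv'T hx' hAm hAC hA0 hAhi
  exact central_transfer_two_sided_of_bricks hβ.le hΩm hCΩ hΩ0 hW hCW hW0 hδu1 hT hσ0 hσ hΩt hWc hχm hCχ hχ0 hχw hI0 hv' hv'T hx' hAm hAC zero_le_one zero_le_one
    hC1c ⟨hlo, hhi⟩

end Summit.QuantumFields.YangMills.Theorems.FemtoTransferGap.TwoLattice.ConstTube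

end
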